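import Mathlib.Tactic.FinCases
import Literature.Computability.MetaComplexity.BoundedArithDefinability
import HarnessLib

/-!
# Composition of definable functions and predicates

Trunk: CplxMeta (G14), topic `Literature/Computability/MetaComplexity` (continuation of
`BoundedArithDefinability.lean`).  Further closure properties of the definability classes
`IsQFDef`, `IsSigmabDef i`, `IsPibDef i`, `IsDeltabDef i`, `IsTermFn`, `IsSigmabFn i`
(Buss 1986, §2.2, Thm. 2.2: substituting `Σᵇ₁`-defined function symbols keeps the class):

* `ClosedUnderTermSubst.substAll`, `IsTermFn.substAll`, `IsSigmabFn.substAll` — substituting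
  term functions for *all* arguments at once;
* `IsSigmabFn.snocTerm` / `IsSigmabFn.snocFn` — substituting a term function / a definable
  function for the last argument of a definable function;
* `IsSigmabFn.comp₂FnFn` — a binary definable function of two definable functions;
* `IsSigmabFn.isSigmabDef_apply_eq` — `u ↦ u_k = G(u ∘ e)`.

## References

* S. R. Buss, *Bounded Arithmetic*, Bibliopolis 1986, §2.2 (Thm. 2.2).
-/

namespace Literature.Computability.MetaComplexity

open FirstOrder FirstOrder.Language

/-! ## Values of definable functions at chosen coordinates; exchanging arguments -/

section Composition

variable {M : Type} [Language.boundedArith.Structure M] {m i : ℕ}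

/-- For a `Σᵇᵢ`-definable `G`, the predicate `u ↦ u_k = G(u ∘ e)` (value at a chosen coordinate,
arguments at chosen coordinates) is `Σᵇᵢ`-definable. [folklore] -/
theorem IsSigmabFn.isSigmabDef_apply_eq {G : (Fin m → M) → M} (hG : IsSigmabFn i G) {n : ℕ}
    (k : Fin n) (e : Fin m → Fin n) : IsSigmabDef i fun u : Fin n → M => u k = G (u ∘ e) := by
  refine (hG.graph.comp (Fin.snoc (α := fun _ => Fin n) e k)).of_iff fun u => ?_
  have e1 : (u ∘ Fin.snoc (α := fun _ => Fin n) e k) (Fin.last m) = u k := by simp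
  have e2 : Fin.init (u ∘ Fin.snoc (α := fun _ => Fin n) e k) = u ∘ e := by
    funext j
    simp [Fin.init]
  simp only [graphPred, e1, e2]

/-- For a `Σᵇᵢ₊₁`-definable `G`, the predicate `u ↦ u_k = G(u ∘ e)` is `Πᵇᵢ₊₁`-definable.
[folklore] -/
theorem IsSigmabFn.isPibDef_apply_eq {G : (Fin m → M) → M} (hG : IsSigmabFn (i + 1) G) {n : ℕ}
    (k : Fin n) (e : Fin m → Fin n) : IsPibDef (i + 1) fun u : Fin n → M => u k = G (u ∘ e) := by
  refine (hG.isPibDef_graph.comp (Fin.snoc (α := fun _ => Fin n) e k)).of_iff fun u => ?_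
  have e1 : (u ∘ Fin.snoc (α := fun _ => Fin n) e k) (Fin.last m) = u k := by simp
  have e2 : Fin.init (u ∘ Fin.snoc (α := fun _ => Fin n) e k) = u ∘ e := by
    funext j
    simp [Fin.init]
  simp only [graphPred, e1, e2]

/-- Composition `f(G(x̄), H(x̄))` of a binary `Σᵇᵢ₊₁`-definable function with two
`Σᵇᵢ₊₁`-definable functions, given a bounding term for the composite:
`y = f(G x̄, H x̄) ↔ ∃ z₁ ≤ t_G ∃ z₂ ≤ t_H (z₁ = G x̄ ∧ z₂ = H x̄ ∧ y = f(z₁, z₂))` (Buss 1986, §2.2).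
[cite: Buss1986, §2.2] -/
theorem IsSigmabFn.comp₂FnFn {f : M → M → M}
    (hf : IsSigmabFn (i + 1) fun w : Fin 2 → M => f (w 0) (w 1)) {G H : (Fin m → M) → M}
    (hG : IsSigmabFn (i + 1) G) (hH : IsSigmabFn (i + 1) H)
    (hbd : IsBoundedFn fun xs => f (G xs) (H xs)) : IsSigmabFn (i + 1) fun xs => f (G xs) (H xs) := by
  refine ⟨?_, hbd⟩
  obtain ⟨BG, hBG, hGB⟩ := hG.bounded
  obtain ⟨BH, hBH, hHB⟩ := hH.bounded
  -- on `Fin (m + 3)` = `x̄, y, z₁, z₂`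
  let xs3 : Fin m → Fin (m + 3) := fun j => j.castSucc.castSucc.castSucc
  let iy : Fin (m + 3) := (Fin.last m).castSucc.castSucc
  let iz₁ : Fin (m + 3) := (Fin.last (m + 1)).castSucc
  let iz₂ : Fin (m + 3) := Fin.last (m + 2)
  have hg : IsSigmabDef (i + 1) fun w : Fin 3 → M => w 2 = f (w 0) (w 1) :=
    hf.graph.of_iff fun w => by simp [graphPred, Fin.init]
  have h1 : IsSigmabDef (i + 1) fun u : Fin (m + 3) → M => u iz₁ = G (u ∘ xs3) :=
    hG.isSigmabDef_apply_eq iz₁ xs3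
  have h2 : IsSigmabDef (i + 1) fun u : Fin (m + 3) → M => u iz₂ = H (u ∘ xs3) :=
    hH.isSigmabDef_apply_eq iz₂ xs3
  have h3 : IsSigmabDef (i + 1) fun u : Fin (m + 3) → M => u iy = f (u iz₁) (u iz₂) :=
    (hg.comp₃ (P := fun a b c => c = f a b) (IsTermFn.proj iz₁) (IsTermFn.proj iz₂)
      (IsTermFn.proj iy)).of_iff fun u => Iff.rfl
  have hR := (h1.and (h2.and h3)).bexLE ((hBH.comp Fin.castSucc).comp Fin.castSucc)
  have hR' := hR.bexLE (hBG.comp Fin.castSucc)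
  refine hR'.of_iff fun v => ?_
  simp only [Fin.snoc_last, Fin.snoc_castSucc, graphPred, iz₁, iz₂, iy, xs3, Function.comp_def]
  constructor
  · rintro ⟨z₁, -, z₂, -, rfl, rfl, h⟩
    exact h
  · intro h
    exact ⟨G (Fin.init v), hGB _, H (Fin.init v), hHB _, rfl, rfl, h⟩

omit [Language.boundedArith.Structure M] in
/-- Evaluation of `Fin.snoc` on `Fin 4 → M`, coordinate `0`. [folklore] -/
@[simp] theorem snoc_fin_four_zero (w : Fin 4 → M) (y : M) : (Fin.snoc w y : Fin 5 → M) 0 = w 0 :=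
  rfl

omit [Language.boundedArith.Structure M] in
/-- Evaluation of `Fin.snoc` on `Fin 4 → M`, coordinate `1`. [folklore] -/
@[simp] theorem snoc_fin_four_one (w : Fin 4 → M) (y : M) : (Fin.snoc w y : Fin 5 → M) 1 = w 1 :=
  rfl

omit [Language.boundedArith.Structure M] in
/-- Evaluation of `Fin.snoc` on `Fin 4 → M`, coordinate `2`. [folklore] -/
@[simp] theorem snoc_fin_four_two (w : Fin 4 → M) (y : M) : (Fin.snoc w y : Fin 5 → M) 2 = w 2 :=
  rfl

omit [Language.boundedArith.Structure M] in
/-- Evaluation of `Fin.snoc` on `Fin 4 → M`, coordinate `3`. [folklore] -/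
@[simp] theorem snoc_fin_four_three (w : Fin 4 → M) (y : M) :
    (Fin.snoc w y : Fin 5 → M) 3 = w 3 := rfl

omit [Language.boundedArith.Structure M] in
/-- Evaluation of `Fin.snoc` on `Fin 4 → M`, last coordinate. [folklore] -/
@[simp] theorem snoc_fin_four_four (w : Fin 4 → M) (y : M) : (Fin.snoc w y : Fin 5 → M) 4 = y :=
  rfl

/-- The permutation of `Fin (m + 2)` exchanging the last two coordinates. [folklore] -/
def swapLastTwo (m : ℕ) : Fin (m + 2) → Fin (m + 2) :=
  Fin.snoc (α := fun _ => Fin (m + 2))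
    (Fin.snoc (α := fun _ => Fin (m + 2)) (fun j => j.castSucc.castSucc) (Fin.last (m + 1)))
    (Fin.last m).castSucc

omit [Language.boundedArith.Structure M] in
/-- `u ∘ swapLastTwo = snoc (snoc (init (init u)) u_last) u_{last-1}`. [folklore] -/
theorem comp_swapLastTwo (u : Fin (m + 2) → M) :
    u ∘ swapLastTwo m = Fin.snoc (Fin.snoc (Fin.init (Fin.init u)) (u (Fin.last (m + 1))))
      (u (Fin.last m).castSucc) := by
  funext j
  cases j using Fin.lastCases with
  | last => simp [swapLastTwo]
  | cast j =>
    cases j using Fin.lastCases with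
    | last => simp [swapLastTwo]
    | cast j => simp [swapLastTwo, Fin.init]

/-- **Substituting a term function for the last argument of a `Σᵇᵢ`-definable function**
(the bound is the composite term). [folklore] -/
theorem IsSigmabFn.snocTerm {F : (Fin (m + 1) → M) → M} (hF : IsSigmabFn i F)
    {T : (Fin m → M) → M} (hT : IsTermFn T) :
    IsSigmabFn i fun xs : Fin m → M => F (Fin.snoc xs (T xs)) := by
  refine ⟨?_, ?_⟩
  · -- `Q u := graphPred F (u ∘ swap)`, then substitute `T ∘ init` for the last argument
    have hQ := (hF.graph.comp (swapLastTwo m)).snoc (hT.comp Fin.castSucc)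
    refine hQ.of_iff fun v => ?_
    rw [comp_swapLastTwo]
    simp [graphPred, Fin.init_snoc, Fin.snoc_last]
    rfl
  · obtain ⟨B, hB, hFB⟩ := hF.bounded
    exact ⟨fun xs => B (Fin.snoc xs (T xs)), hB.snoc hT, fun xs => hFB _⟩

/-- **Substituting a `Σᵇᵢ₊₁`-definable function for the last argument of a `Σᵇᵢ₊₁`-definable
function**, given a bounding term for the composite:
`y = F(x̄, G x̄) ↔ ∃ z ≤ t_G(x̄) (z = G x̄ ∧ y = F(x̄, z))` (Buss 1986, §2.2). [cite: Buss1986, §2.2] -/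
theorem IsSigmabFn.snocFn {F : (Fin (m + 1) → M) → M} (hF : IsSigmabFn (i + 1) F)
    {G : (Fin m → M) → M} (hG : IsSigmabFn (i + 1) G)
    (hbd : IsBoundedFn fun xs => F (Fin.snoc xs (G xs))) :
    IsSigmabFn (i + 1) fun xs : Fin m → M => F (Fin.snoc xs (G xs)) := by
  refine ⟨?_, hbd⟩
  obtain ⟨BG, hBG, hGB⟩ := hG.bounded
  -- on `Fin (m + 2)` = `x̄, y, z`:  `z = G x̄ ∧ graphPred F (x̄, z, y)`
  have h1 : IsSigmabDef (i + 1) fun u : Fin (m + 2) → M =>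
      u (Fin.last (m + 1)) = G (u ∘ fun j : Fin m => j.castSucc.castSucc) :=
    hG.isSigmabDef_apply_eq _ _
  have h2 : IsSigmabDef (i + 1) fun u : Fin (m + 2) → M => graphPred F (u ∘ swapLastTwo m) :=
    hF.graph.comp (swapLastTwo m)
  refine ((h1.and h2).bexLE (hBG.comp Fin.castSucc)).of_iff fun v => ?_
  have e : ∀ z : M, (Fin.snoc v z ∘ fun j : Fin m => j.castSucc.castSucc) = Fin.init v := by
    intro z
    funext j
    simp [Fin.init]
  simp only [Fin.snoc_last, comp_swapLastTwo, Fin.init_snoc, Fin.snoc_castSucc, graphPred_snoc, e]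
  constructor
  · rintro ⟨z, -, rfl, h⟩
    rw [graphPred, h]
  · intro h
    refine ⟨G (Fin.init v), hGB _, rfl, ?_⟩
    rw [graphPred] at h
    rw [h]

end Composition

/-! ## Substituting term functions for all arguments at once -/

section SubstAll

variable {M : Type} [Language.boundedArith.Structure M] {m k i : ℕ}

/-- The substitution replacing every argument variable `j` by the term `s j` (parameters fixed).
[folklore] -/
def allSubst (s : Fin k → Language.boundedArith.Term (M ⊕ Fin m)) :
    M ⊕ Fin k → Language.boundedArith.Term (M ⊕ Fin m) :=
  Sum.elim (fun a => var (Sum.inl a)) s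

/-- Semantics of `allSubst`. [folklore] -/
theorem realize_allSubst (s : Fin k → Language.boundedArith.Term (M ⊕ Fin m)) (xs : Fin m → M) :
    (fun x => (allSubst s x).realize (argEnv xs)) =
      argEnv fun j => (s j).realize (argEnv xs) := by
  funext x
  rcases x with a | j <;> rfl

/-- Term functions are closed under substitution of term functions for all arguments.
[folklore] -/
theorem IsTermFn.substAll {F : (Fin k → M) → M} (hF : IsTermFn F)
    {T : Fin k → (Fin m → M) → M} (hT : ∀ j, IsTermFn (T j)) :
    IsTermFn fun xs => F fun j => T j xs := by
  obtain ⟨t, ht⟩ := hF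
  choose s hs using hT
  refine ⟨t.subst (allSubst s), fun xs => ?_⟩
  have e : (fun j => T j xs) = fun j => (s j).realize (argEnv xs) := funext fun j => hs j xs
  dsimp only
  rw [ht, Term.realize_subst, realize_allSubst, e]

/-- Open-definable predicates are closed under substitution of term functions for all
arguments (Buss 1986, §2.1). [cite: Buss1986, §2.1] -/
theorem IsQFDef.substAll {P : (Fin k → M) → Prop} (hP : IsQFDef P)
    {T : Fin k → (Fin m → M) → M} (hT : ∀ j, IsTermFn (T j)) :
    IsQFDef fun xs => P fun j => T j xs := by
  obtain ⟨φ, hφ, h⟩ := hP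
  choose s hs using hT
  refine ⟨φ.subst (allSubst s), isQF_subst hφ _, fun xs => ?_⟩
  have e : (fun j => T j xs) = fun j => (s j).realize (argEnv xs) := funext fun j => hs j xs
  dsimp only
  rw [h, e]
  simp only [Formula.Realize, BoundedFormula.realize_subst, realize_allSubst]

/-- `Σᵇᵢ`-definable predicates are closed under substitution of term functions for all
arguments (Buss 1986, §2.1). [cite: Buss1986, §2.1] -/
theorem IsSigmabDef.substAll {P : (Fin k → M) → Prop} (hP : IsSigmabDef i P)
    {T : Fin k → (Fin m → M) → M} (hT : ∀ j, IsTermFn (T j)) :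
    IsSigmabDef i fun xs => P fun j => T j xs := by
  obtain ⟨φ, hφ, h⟩ := hP
  choose s hs using hT
  refine ⟨φ.subst (allSubst s), hφ.subst _, fun xs => ?_⟩
  have e : (fun j => T j xs) = fun j => (s j).realize (argEnv xs) := funext fun j => hs j xs
  dsimp only
  rw [h, e]
  simp only [Formula.Realize, BoundedFormula.realize_subst, realize_allSubst]

/-- `Πᵇᵢ`-definable predicates are closed under substitution of term functions for all
arguments (Buss 1986, §2.1). [cite: Buss1986, §2.1] -/
theorem IsPibDef.substAll {P : (Fin k → M) → Prop} (hP : IsPibDef i P)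
    {T : Fin k → (Fin m → M) → M} (hT : ∀ j, IsTermFn (T j)) :
    IsPibDef i fun xs => P fun j => T j xs := by
  obtain ⟨φ, hφ, h⟩ := hP
  choose s hs using hT
  refine ⟨φ.subst (allSubst s), hφ.subst _, fun xs => ?_⟩
  have e : (fun j => T j xs) = fun j => (s j).realize (argEnv xs) := funext fun j => hs j xs
  dsimp only
  rw [h, e]
  simp only [Formula.Realize, BoundedFormula.realize_subst, realize_allSubst]

/-- `Δᵇᵢ`-definable predicates are closed under substitution of term functions for all
arguments. [folklore] -/
theorem IsDeltabDef.substAll {P : (Fin k → M) → Prop} (hP : IsDeltabDef i P)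
    {T : Fin k → (Fin m → M) → M} (hT : ∀ j, IsTermFn (T j)) :
    IsDeltabDef i fun xs => P fun j => T j xs :=
  ⟨hP.1.substAll hT, hP.2.substAll hT⟩

/-- `Σᵇ`-definable functions are closed under substitution of term functions for all arguments
(the bound is the composite term) (Buss 1986, §2.2). [cite: Buss1986, §2.2] -/
theorem IsSigmabFn.substAll {F : (Fin k → M) → M} (hF : IsSigmabFn i F)
    {T : Fin k → (Fin m → M) → M} (hT : ∀ j, IsTermFn (T j)) :
    IsSigmabFn i fun xs => F fun j => T j xs := by
  refine ⟨?_, ?_⟩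
  · -- graph: `v_last = F (T₀ (init v), …)` = `graphPred F (T₀ (init v), …, v_last)`
    let T' : Fin (k + 1) → (Fin (m + 1) → M) → M :=
      Fin.snoc (α := fun _ => (Fin (m + 1) → M) → M) (fun j v => T j (Fin.init v))
        fun v => v (Fin.last m)
    have hT' : ∀ j, IsTermFn (T' j) := by
      intro j
      cases j using Fin.lastCases with
      | last => simpa [T'] using IsTermFn.proj (Fin.last m)
      | cast j =>
        simp only [T', Fin.snoc_castSucc]
        exact ((hT j).comp Fin.castSucc).of_eq fun v => rfl
    refine (hF.graph.substAll hT').of_iff fun v => ?_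
    have e1 : (fun j => T' j v) (Fin.last k) = v (Fin.last m) := by simp [T']
    have e2 : Fin.init (fun j => T' j v) = fun j => T j (Fin.init v) := by
      funext j
      simp [T', Fin.init]
    simp only [graphPred, e1, e2]
  · obtain ⟨B, hB, hFB⟩ := hF.bounded
    exact ⟨fun xs => B fun j => T j xs, hB.substAll hT, fun xs => hFB _⟩

end SubstAll

end Literature.Computability.MetaComplexity
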